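import Summits.QuantumFields.QCD.Theorems.QuarksAsStableActionCriticalLineDiamagnetismRectFreqOpStatic
import Summits.QuantumFields.QCD.Theorems.QuarksAsStableActionCriticalLineDiamagnetismRectFreqOpTranspose
import Summits.QuantumFields.QCD.Theorems.QuarksAsStableActionCriticalLineDiamagnetismEvenCycleChessboard
import Summits.QuantumFields.QCD.Theorems.QuarksAsStableActionCriticalLineDiamagnetismStaticPressureOdd

/-!
# Route B helper `staticDiamagEven` for stub `stub_heavyFrequencyGain` of line `Sketch` — diamagnetism of
first-coordinate-static fields on lattices `ℤ/L₁ × ℤ/(2n)` with EVEN second length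
(crux `Summit.QuantumFields.QCD.Theses.QuarksAsStableAction.CriticalLineDiamagnetism`, item stmt-QuantumFields-9734,
static route for odd tori, Route B of the heavy-frequency gain)

For `r : ℤ/(2n) → U(3)`, `m > −1` and a real frequency pair, the static field `S` on `ℤ/L₁ × ℤ/(2n)` with links `r x`
along the second coordinate on every row (and trivial links along the first) obeys
`‖det D[S]‖ ≤ ‖det D[1]‖` (`D = freqOpR euclideanGamma`; `staticDiamagEven`, registered).

Proof.  Transposing (`det_freqOpR_transpose`) turns `S` into a field `T` on `ℤ/(2n) × ℤ/L₁` whose links along the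
SECOND (slice) coordinate are all trivial; its links along the first ("time") coordinate are the `r b`.  For such a
field Lüscher's transfer form (`tfreqOpR_det_transfer_form` on the even circle `ℤ/(2n)`) reads
`det D[T] = (∏_t det E_t) · det (1 − ∏_{i<2n} M W_i)` where EVERY dressed one-step matrix is the free one `M = M_free`
(the slice data only read the slice links: `sliceOpR_congr`, `oneStepR_congr`), the `W_i` are unitary, and
`‖det E_t‖ = e_free` (`stub_normDetChainBlock`).  On the fermionic Fock space, with the letters `B_j := Γ(M W̃_j)`
(`W̃_j = W_j` except `W̃_{2n−1} = −W_{2n−1}`, so that `∏ M W̃_j = −∏ M W_j` and `Tr Γ(X) = det (1 + X)`), the even-cycle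
chessboard estimate (`evenCycleChessboard`, the generalised Hölder inequality with `2n` equal exponents) gives
`‖det (1 − ∏ M W_i)‖^{2n} ≤ ∏_j Re Tr ((B_j B_jᴴ)^n) = (Re det (1 + M^{2n}))^{2n}`, since `B_j B_jᴴ = Γ(M W̃_j W̃_jᴴ M) = Γ(M²)`
by unitarity.  Hence `‖det D[T]‖ ≤ e_free^{2n} · Re det (1 + M_free^{2n}) = ‖det D[1]‖` (`norm_det_freqOpR_rowStatic`), and the
free field is its own transpose.  Pure theorem file (no definitions).
References: M. Lüscher, Commun. Math. Phys. 54 (1977) 283; J. Fröhlich, R. Israel, E. H. Lieb, B. Simon, Commun. Math.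
Phys. 62 (1978) 1, Thm. 4.1; B. Simon, *Trace ideals and their applications*, Thm. 2.8.
-/

noncomputable section

open scoped BigOperators Matrix ComplexConjugate ComplexOrder MatrixOrder
open Finset
open Literature.MathematicalPhysics.QuantumLattice Literature.MathematicalPhysics.QuantumFieldTheory
  Literature.Probability.LatticeModels

namespace Summit.QuantumFields.QCD.Cruxes.CriticalLineDiamagnetism.ChessboardCellGain

namespace FrequencyDiamagnetism

namespace StaticDiamagEven

open Matrix Complex
open Summit.QuantumFields.QCD.Cruxes.StableActionBridge.Sketch
open Summit.QuantumFields.QCD.Cruxes.WilsonQuarkStability.FreeTangentLandauChessboard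

/-! ### Hölder on Fock space: a constant positive one-step matrix and arbitrary unitary transporters -/

/-- **The even-cycle Hölder bound at determinant level.**  For a positive semidefinite `M` and unitary `W_i`,
`‖det (1 − ∏_{i<2n} M W_i)‖ ≤ Re det (1 + M^{2n})`: the even-cycle chessboard estimate on the fermionic Fock space for
the letters `B_j = Γ(M W̃_j)` (`W̃` = `W` with the last transporter negated), for which `∏_j B_j = Γ(−∏ M W_i)`,
`Tr Γ(X) = det (1 + X)` and `B_j B_jᴴ = Γ(M²)`. -/
theorem norm_det_one_sub_prod_le {k : Type} [Fintype k] [DecidableEq k] (n : ℕ) [NeZero n] {M : Matrix k k ℂ}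
    (hM : M.PosSemidef) (W : ℕ → Matrix k k ℂ) (hW : ∀ i, W i ∈ Matrix.unitaryGroup k ℂ) :
    ‖(1 - ((List.range (2 * n)).map fun i : ℕ => M * W i).prod).det‖ ≤ ((1 + M ^ (2 * n)).det).re := by
  -- a linear order on `k` (to enumerate Fock states), with the ambient decidable equality
  -- adapted from `mixedSchwarzDet` (…CriticalLineDiamagnetismMixedSchwarzDet.lean)
  letI lo : LinearOrder k :=
    { le := fun a b => Fintype.equivFin k a ≤ Fintype.equivFin k b
      le_refl := fun a => le_refl _
      le_trans := fun a b c => le_trans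
      le_antisymm := fun a b h1 h2 => (Fintype.equivFin k).injective (le_antisymm h1 h2)
      le_total := fun a b => le_total _ _
      toDecidableLE := fun a b => inferInstanceAs (Decidable (Fintype.equivFin k a ≤ Fintype.equivFin k b))
      toDecidableEq := inferInstance }
  have hn : 0 < n := Nat.pos_of_ne_zero (NeZero.ne n)
  have hL : 2 * n - 1 + 1 = 2 * n := by omega
  -- negate the last transporter
  obtain ⟨U, hU⟩ : ∃ U : ℕ → Matrix k k ℂ, ∀ i, U i = if i = 2 * n - 1 then -W i else W i := ⟨_, fun _ => rfl⟩
  have hUu : ∀ i, U i * (U i)ᴴ = 1 := fun i => by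
    have h := Matrix.mem_unitaryGroup_iff.mp (hW i)
    rw [star_eq_conjTranspose] at h
    by_cases hi : i = 2 * n - 1
    · rw [hU, if_pos hi, conjTranspose_neg, neg_mul_neg, h]
    · rw [hU, if_neg hi, h]
  have hprodU : ((List.range (2 * n)).map fun i : ℕ => M * U i).prod =
      -((List.range (2 * n)).map fun i : ℕ => M * W i).prod := by
    refine APDetTransferForm.prod_map_range_eq_neg hL _ _ (fun i hi => ?_) ?_
    · show M * U i = M * W i
      rw [hU, if_neg (Nat.ne_of_lt hi)]
    · show M * U (2 * n - 1) = -(M * W (2 * n - 1))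
      rw [hU, if_pos rfl, Matrix.mul_neg]
  -- the even-cycle chessboard estimate on Fock space for the letters `Γ(M U_j)`
  have key := evenCycleChessboard n hn (fun j : Fin (2 * n) => fockLift (M * U j))
  have hlist : List.ofFn (fun j : Fin (2 * n) => fockLift (M * U j)) =
      ((List.range (2 * n)).map fun i : ℕ => M * U i).map fockLift := by
    rw [List.ofFn_eq_map, ← List.map_coe_finRange_eq_range, List.map_map, List.map_map]
    exact List.map_congr_left fun j _ => rfl
  have hlhs : (List.ofFn (fun j : Fin (2 * n) => fockLift (M * U j))).prod.trace =
      (1 - ((List.range (2 * n)).map fun i : ℕ => M * W i).prod).det := by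
    rw [hlist, ← StaticSliceBound.fockLift_list_prod, FockLiftPosDef.trace_fockLift, hprodU, ← sub_eq_add_neg]
  have hrhs : ∀ j : Fin (2 * n), ((fockLift (M * U j) * (fockLift (M * U j))ᴴ) ^ n).trace.re =
      ((1 + M ^ (2 * n)).det).re := fun j => by
    have h1 : fockLift (M * U j) * (fockLift (M * U j))ᴴ = fockLift (M * M) := by
      rw [← FockLiftPosDef.fockLift_conjTranspose, ← FockLiftPosDef.fockLift_mul, conjTranspose_mul, hM.1.eq,
        Matrix.mul_assoc, ← Matrix.mul_assoc (U j), hUu, Matrix.one_mul]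
    rw [h1, ← StaticSliceBound.fockLift_pow, FockLiftPosDef.trace_fockLift, ← sq, ← pow_mul]
  rw [hlhs, Finset.prod_congr rfl fun j _ => hrhs j, Finset.prod_const, Finset.card_univ, Fintype.card_fin] at key
  exact le_of_pow_le_pow_left₀ (by omega) (re_det_one_add_pow_pos hM (2 * n)).le key

/-! ### Fields with trivial slice links on the even time circle -/

/-- **A field on `ℤ/(2n) × ℤ/L` whose links along the second coordinate are all trivial is dominated by the free
field**: `‖det D[T]‖ ≤ ‖det D[1]‖` for `m > −1` — all its dressed one-step matrices are the free one, its transporters are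
unitary, and the even-cycle Hölder bound applies. -/
theorem norm_det_trivialSlice_le {n L : ℕ} [NeZero n] [NeZero L]
    (T : ZMod (2 * n) → ZMod L → Fin 4 → Matrix.unitaryGroup (Fin 3) ℂ) (h3 : ∀ t x, T t x 3 = 1)
    {m : ℝ} (hm : -1 < m) (ω₀ ω₁ : ℝ) :
    ‖(freqOpR euclideanGamma T m ω₀ ω₁).det‖ ≤
      ‖(freqOpR euclideanGamma (fun (_ : ZMod (2 * n)) (_ : ZMod L) (_ : Fin 4) =>
        (1 : Matrix.unitaryGroup (Fin 3) ℂ)) m ω₀ ω₁).det‖ := by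
  -- the one-row free field, whose slice data are those of every row of `T`
  obtain ⟨A₁, hA₁⟩ : ∃ A₁ : ZMod 1 → ZMod L → Fin 4 → Matrix.unitaryGroup (Fin 3) ℂ, ∀ t x μ, A₁ t x μ = 1 :=
    ⟨fun _ _ _ => 1, fun _ _ _ => rfl⟩
  have hT3 : ∀ (t : ZMod (2 * n)) (x : ZMod L), T t x 3 = A₁ 0 x 3 := fun t x => by rw [h3, hA₁]
  have hA : ∀ t, sliceOpR T m ω₀ ω₁ t = sliceOpR A₁ m ω₀ ω₁ 0 := fun t => sliceOpR_congr A₁ T m ω₀ ω₁ t 0 (hT3 t)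
  have hM : ∀ t, oneStepR T m ω₀ ω₁ t = oneStepR A₁ m ω₀ ω₁ 0 := fun t => oneStepR_congr A₁ T m ω₀ ω₁ t 0 (hT3 t)
  -- Lüscher's transfer form on the `2n`-circle and positivity of the free one-step matrix
  obtain ⟨hdet, hMpos⟩ := tfreqOpR_det_transfer_form T hm ω₀ ω₁
  have hM₁ : (oneStepR A₁ m ω₀ ω₁ 0).PosDef := hM 0 ▸ hMpos 0
  -- the transporters are unitary
  have hsp := fun t : ZMod (2 * n) => slice_spin_structureR T m ω₀ ω₁ t
  have hW'u : ∀ t, link2R' T t ∈ Matrix.unitaryGroup _ ℂ := fun t =>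
    Matrix.mem_unitaryGroup_iff.mpr (by rw [star_link2R', (hsp t).2.2.2.2.2.2.2.2])
  have hWu : ∀ t, link2R T t ∈ Matrix.unitaryGroup _ ℂ := fun t => by
    rw [← star_link2R']
    exact Unitary.star_mem (hW'u t)
  -- the e-factors are blind to the transporters (`stub_normDetChainBlock`)
  have hP : projP L + projM L = 1 := liftProjPlus_add_liftProjMinus (ZMod L) 3
  have hPQ : projP L * projM L = 0 := liftProjPlus_mul_liftProjMinus (ZMod L) 3
  have hQP : projM L * projP L = 0 := liftProjMinus_mul_liftProjPlus (ZMod L) 3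
  have hPph : (projP L)ᴴ = projP L := (slice_claimsR T hm ω₀ ω₁ 0).2.2.1
  have hPmh : (projM L)ᴴ = projM L := (slice_claimsR T hm ω₀ ω₁ 0).2.2.2.1
  have hEV : ∀ s, ‖(sliceOpR T m ω₀ ω₁ s * projM L - projP L * link2R' T (s - 1)).det‖ =
      ‖(sliceOpR A₁ m ω₀ ω₁ 0 * projM L - projP L).det‖ := fun s => by
    rw [hA s]
    exact stub_normDetChainBlock _ _ _ _ hP hPQ hQP hPph hPmh (hW'u _) (hsp (s - 1)).2.2.2.2.2.2.1
      (hsp (s - 1)).2.2.2.2.2.2.2.1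
  -- every one-step matrix is the free one
  have hprod : ((List.range (2 * n)).map fun i : ℕ =>
      oneStepR T m ω₀ ω₁ (i : ZMod (2 * n)) * link2R T (i : ZMod (2 * n))).prod =
      ((List.range (2 * n)).map fun i : ℕ => oneStepR A₁ m ω₀ ω₁ 0 * link2R T (i : ZMod (2 * n))).prod :=
    congrArg List.prod (List.map_congr_left fun i _ => by rw [hM])
  -- Hölder on Fock space, the free determinant in normal form, assembly
  have hH := norm_det_one_sub_prod_le n hM₁.posSemidef (fun i : ℕ => link2R T (i : ZMod (2 * n))) fun i => hWu _
  have hfree := norm_det_freqOpR_rowStatic A₁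
    (fun (_ : ZMod (2 * n)) (_ : ZMod L) (_ : Fin 4) => (1 : Matrix.unitaryGroup (Fin 3) ℂ))
    (fun _ _ => rfl) (fun _ x => (hA₁ 0 x 3).symm) hm ω₀ ω₁
  rw [hfree, ← det_tfreqOpR, hdet, norm_mul, norm_prod, Finset.prod_congr rfl fun s _ => hEV s, Finset.prod_const,
    Finset.card_univ, ZMod.card, hprod]
  exact mul_le_mul_of_nonneg_left hH (pow_nonneg (norm_nonneg _) _)

end StaticDiamagEven

end FrequencyDiamagnetism

/-! ### The registered helper theorem -/

open FrequencyDiamagnetism in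
/-- **Route B helper `staticDiamagEven`** (diamagnetism of first-coordinate-static fields when the second length is
EVEN): for `r : ℤ/(2n) → U(3)`, `m > −1` and a real frequency pair, the field on `ℤ/L₁ × ℤ/(2n)` with links `r x` along
the second coordinate on every row and trivial links along the first is dominated by the free field,
`‖det D[S]‖ ≤ ‖det D[1]‖` — transpose (`det_freqOpR_transpose`), Lüscher's transfer form on the even circle `ℤ/(2n)`
with the FREE one-step matrix on every row, and the even-cycle chessboard (Hölder) bound on Fock space
(`StaticDiamagEven.norm_det_one_sub_prod_le`). -/
theorem staticDiamagEven : ∀ (L₁ n : ℕ) [NeZero L₁] [NeZero n] (r : ZMod (2 * n) → Matrix.unitaryGroup (Fin 3) ℂ) (m : ℝ), -1 < m → ∀ ω₀ ω₁ : ℝ, ‖(freqOpR euclideanGamma (fun (_ : ZMod L₁) (x : ZMod (2 * n)) (μ : Fin 4) => if μ = 3 then r x else 1) m ω₀ ω₁).det‖ ≤ ‖(freqOpR euclideanGamma (fun (_ : ZMod L₁) (_ : ZMod (2 * n)) (_ : Fin 4) => (1 : Matrix.unitaryGroup (Fin 3) ℂ)) m ω₀ ω₁).det‖ := by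
  intro L₁ n _ _ r m hm ω₀ ω₁
  have h1 := det_freqOpR_transpose
    (fun (_ : ZMod L₁) (x : ZMod (2 * n)) (μ : Fin 4) => if μ = 3 then r x else (1 : Matrix.unitaryGroup (Fin 3) ℂ))
    m ω₀ ω₁
  have h2 := det_freqOpR_transpose
    (fun (_ : ZMod L₁) (_ : ZMod (2 * n)) (_ : Fin 4) => (1 : Matrix.unitaryGroup (Fin 3) ℂ)) m ω₀ ω₁
  rw [h1, h2]
  refine StaticDiamagEven.norm_det_trivialSlice_le _ (fun t x => ?_) hm ω₀ ω₁
  exact if_neg (by decide)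

end Summit.QuantumFields.QCD.Cruxes.CriticalLineDiamagnetism.ChessboardCellGain

end
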